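/-
Copyright (c) 2026 the pub-hodgecm-mathlib formalisation cell (harness21).  Prover seat hodgecm-mathlib-K2E3-p14 (g2), Track B «K2-LIT» ∕ h413
(`stmt-HodgeConjecture-24833`), line `K2_E3_EllipticInputs`, unit U12, socket U12-g ‹13a› `sig_K2E3LocalIrrepAdmissible`, road A, item (B) «hcartanLevi(S)»
first rung `#(univ ∖ S) = 1` (dealer K2E3-plan (g2) 01:04:01Z, line lead K2E3-p10 (g3) RULINGS #1), part 2∕2: the Cartan decomposition of the maximal Levi.
2026-09-04.
-/
import Summits.HodgeConjecture.HodgeConjecture.Theorems.K2E3UnitaryBlockLeviReconstruction   -- ★ p856382 (this seat): part 1∕2 (labels, reconstruction, centre, cones)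
import Summits.HodgeConjecture.HodgeConjecture.Theorems.K2E3WittCartanUnramified             -- ★ p856208 (K2E3-p10): `prod_wittCoweight_pow_eq_zpow`, `wittFormOn_eq_over_of_std`
import Summits.HodgeConjecture.HodgeConjecture.Theorems.K2E3WittLeviCuspidalDichotomyOfCartan -- ★ p856271 (K2E3-p10): `wittCocharacter_mem_wittLevi`, `commute_wittCocharacter_levi`
import Literature.NumberTheory.Automorphic.CartanDecompositionGLnPowers                      -- ★ `exists_glInt_mul_mul_eq_zpowDiagGL` (Cartan of `GL_c(K)`)
import Literature.NumberTheory.Automorphic.ValuedFieldValuativeRelBridge                     -- ★ `isUniformizingElement_of_v_eq`, `isDiscreteValuationRing_integer_of_compatible`, `v_le_one_iff_mem_integer`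
import HarnessLib

/-!
# Crux `H413` — K2-LIT E3 «EllipticInputs», 13a road A, item (B) part 2∕2: THE CARTAN DECOMPOSITION OF THE MAXIMAL WITT LEVI
# `M_{univ ∖ α} = (K₀ ∩ M) · {∏_{β ≠ α} a_β(ϖ)^{n β}} · (K₀ ∩ M) · Z(M)` AT AN UNRAMIFIED QUASI-SPLIT PLACE

Cell `hodgecm-mathlib`, Track B «K2-LIT», crux item `stmt-HodgeConjecture-24833` (h413), socket U12-g `sig_K2E3LocalIrrepAdmissible`, road A.  ★ (F) p856336
`isAdmissible_of_leviCartan_unramified` is Jacquet's admissibility theorem for `U(σ, W)(K)` modulo the letter `hLevi : ∀ S, hcartanLevi(S)` (frozen shape of the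
line lead's RULINGS #1, = the `hcartan` binder of ★ p856271 with `K₀ = unitaryInt`).  THIS FILE proves `hcartanLevi(S)` for the MAXIMAL standard Levis
`S = univ.erase α` (the dealer's first rung `#(univ ∖ S) = 1`): `M_{univ∖α} ≅ GL_c(K) × U(σ, J₀^{(N−2c)})(K)`, `c = α + 1` (★ `HyperspecialUnitaryParabolicBlocks`, ★ part 1
p856382), the Cartan decompositions of the two factors — ★ `exists_glInt_mul_mul_eq_zpowDiagGL` (`GL_c = GL_c(𝒪) ϖ^{a} GL_c(𝒪)`, `a` antitone) and ★
`heckeCosetMk_zpowDiagGL_eq_of_unitary` (`U(J₀^{(N′)}) = K₀′ ϖ^{b} K₀′`, `b` antitone, `b ∘ rev = −b`) — glued by ★ `blockDiagLift`, and the CONE BOOKKEEPING: the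
diagonal `E = (a | b | −a ∘ rev)` of the glued torus element is `E′ + χ` with `χ = t · (1 − blockLabel)` (`t = a_c − b_1`) central in `M` and `E′` antitone,
`rev`-antisymmetric with vanishing `α`-th simple-root exponent, so that ★ `prod_wittCoweight_pow_eq_zpow` writes `ϖ^{E′}` as `∏_{β ≠ α} a_β(ϖ)^{n β}`.

* §1 exponent bookkeeping on the three blocks (`antitone_of_blockwise`, `rev_eq_neg_of_blockwise`);
* §2 `coe_blockDiagLift_zpowDiagGL`: `diag(ϖ^a, ϖ^b, (ϖ^a)†) = ϖ^E`;
* §3 **`exists_leviCartan_unramified_erase`** — the frozen (B) shape at `S = univ.erase α` (context `[Valued K ℤᵐ⁰] [ValuativeRel K] [Valued.v.Compatible]`,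
  the GL Cartan being a `ValuativeRel` theorem).

`--supports stmt-HodgeConjecture-24833 --as helper`.  THEOREMS ONLY — no `def`, no named fact, no instance, no notation, no `sorry`.  HONEST LABEL: HC_CM is proved
only modulo the 7 printed citations (2 remaining named inputs: hLiu418 = stmt-HodgeConjecture-24832, h413 = stmt-HodgeConjecture-24833) until rung 0 closes; this
is the `#(univ ∖ S) = 1` rung of item (B) — with it, ★ (F) and ★ `S = univ` (p856208) the letter `hLevi` is discharged for `r ≤ 1` (`N ≤ 3`); the general `S`
(`#(univ ∖ S) ≥ 2`, `N ≥ 4`) is the recursion over the middle block, not in this file.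

## References
* [BruhatTits1972] F. Bruhat, J. Tits, *Groupes réductifs sur un corps local I*, Publ. Math. IHÉS 41 (1972), (4.4.3).
* [Tits1979] J. Tits, *Reductive groups over local fields*, PSPM 33.1 (1979), §3.3.3.
* [CartierCorvallis1979] P. Cartier, *Representations of 𝔭-adic groups: a survey*, PSPM 33.1 (1979), §IV.2.
* [Casselman1995] W. Casselman, *Introduction to the theory of admissible representations of p-adic reductive groups* (1995), Thm. 5.3.1.
* [Borel1991] A. Borel, *Linear Algebraic Groups*, GTM 126 (1991), §23.
-/

set_option autoImplicit false
-- the mandated namespace repeats `HodgeConjecture.HodgeConjecture`, as in every `Theorems/*.lean` of this sub-problem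
set_option linter.dupNamespace false

noncomputable section

open scoped MatrixGroups WithZero
open Matrix ValuativeRel

namespace Summit.HodgeConjecture.HodgeConjecture.Cruxes.H413.K2E3WittLeviCartanUnramifiedMaximal

open Literature.NumberTheory.Automorphic Literature.NumberTheory.Automorphic.UnitaryGroup Literature.NumberTheory.Automorphic.HermitianLattice
open K2E3LocalUnitaryWitt K2E3WittConeContraction K2E3WittCartanUnramified K2E3WittLeviCuspidalDichotomyOfCartan K2E3UnitaryBlockLeviReconstruction

/-! ## §1 Exponent bookkeeping on the three blocks `[0, c) | [c, N − c) | [N − c, N)` -/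

section Exponents

variable {N c : ℕ} (hc : 2 * c ≤ N)

/-- **Antitone from blockwise data**: a function on `Fin N` antitone on each of the three blocks and decreasing across the three junctions (every value on an
earlier block dominates every value on a later block) is antitone. [cite: BruhatTits1972, (4.4.3)] -/
theorem antitone_of_blockwise {E : Fin N → ℤ}
    (h00 : ∀ i i' : Fin c, i ≤ i' → E (Fin.castLE (le_of_two_mul_le hc) i') ≤ E (Fin.castLE (le_of_two_mul_le hc) i))
    (h11 : ∀ j j' : Fin (N - 2 * c), j ≤ j' → E (midIndex hc j') ≤ E (midIndex hc j))
    (h22 : ∀ i i' : Fin c, i ≤ i' → E (hiIndex hc i') ≤ E (hiIndex hc i))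
    (h01 : ∀ (i : Fin c) (j : Fin (N - 2 * c)), E (midIndex hc j) ≤ E (Fin.castLE (le_of_two_mul_le hc) i))
    (h02 : ∀ i i' : Fin c, E (hiIndex hc i') ≤ E (Fin.castLE (le_of_two_mul_le hc) i))
    (h12 : ∀ (j : Fin (N - 2 * c)) (i' : Fin c), E (hiIndex hc i') ≤ E (midIndex hc j)) : Antitone E := by
  intro p q hpq
  rw [Fin.le_iff_val_le_val] at hpq
  obtain ⟨x, rfl⟩ := (blockSum hc).surjective p
  obtain ⟨y, rfl⟩ := (blockSum hc).surjective q
  rcases x with (i | i) | i <;> rcases y with (j | j) | j <;>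
    simp only [blockSum_inl_inl, blockSum_inl_inr, blockSum_inr, Fin.val_castLE, coe_midIndex, coe_hiIndex] at hpq ⊢
  · exact h00 i j (Fin.le_iff_val_le_val.2 hpq)
  · exact h01 i j
  · exact h02 i j
  · exact absurd hpq (by have := j.isLt; omega)
  · exact h11 i j (Fin.le_iff_val_le_val.2 (by omega))
  · exact h12 i j
  · exact absurd hpq (by have := j.isLt; have := i.isLt; omega)
  · exact absurd hpq (by have := j.isLt; have := i.isLt; omega)
  · exact h22 i j (Fin.le_iff_val_le_val.2 (by omega))

/-- **`rev`-antisymmetry from blockwise data**: `E (rev p) = −E p` once the last block mirrors the first (`E (hiIndex (rev i)) = −E (castLE i)`) and the middle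
block is antisymmetric. [cite: BruhatTits1972, (4.4.3)] -/
theorem rev_eq_neg_of_blockwise {E : Fin N → ℤ} (h0 : ∀ i : Fin c, E (hiIndex hc (Fin.rev i)) = -E (Fin.castLE (le_of_two_mul_le hc) i))
    (h1 : ∀ j : Fin (N - 2 * c), E (midIndex hc (Fin.rev j)) = -E (midIndex hc j)) (p : Fin N) : E (Fin.rev p) = -E p := by
  obtain ⟨x, rfl⟩ := (blockSum hc).surjective p
  rcases x with (i | i) | i
  · rw [blockSum_inl_inl, rev_castLE hc, h0]
  · rw [blockSum_inl_inr, rev_midIndex hc, h1]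
  · rw [blockSum_inr, rev_hiIndex hc]
    have h := h0 (Fin.rev i)
    rw [Fin.rev_rev] at h
    rw [h, neg_neg]

end Exponents

/-! ## §2 The glued torus element `diag(ϖ^a, ϖ^b, (ϖ^a)†)` is `ϖ^E` -/

section Torus

variable {K : Type*} [Field K] {σ : K →+* K} (hσ : ∀ x, σ (σ x) = x) {N c : ℕ} (hc : 2 * c ≤ N)

/-- **`blockDiagLift (ϖ^a) (ϖ^b) = ϖ^E`** with `E = (a | b | −a ∘ rev)` on the three blocks (the dual block of `ϖ^a` is `σ(ϖ^{−a(rev ·)}) = ϖ^{−a ∘ rev}` as `σ ϖ = ϖ`).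
[cite: BruhatTits1972, (4.4.3)] [cite: Tits1979, §3.3.3] -/
theorem coe_blockDiagLift_zpowDiagGL {ϖ : K} (hϖ0 : ϖ ≠ 0) (hσϖ : σ ϖ = ϖ) (a : Fin c → ℤ) {b : Fin (N - 2 * c) → ℤ}
    (hbrev : ∀ j, b (Fin.rev j) = -b j) (E : Fin N → ℤ) (hE0 : ∀ i, E (Fin.castLE (le_of_two_mul_le hc) i) = a i)
    (hE1 : ∀ j, E (midIndex hc j) = b j) (hE2 : ∀ i, E (hiIndex hc i) = -a (Fin.rev i)) :
    (blockDiagLift hσ hc (zpowDiagGL hϖ0 a) ⟨zpowDiagGL hϖ0 b, zpowDiagGL_mem_unitaryGroupOfForm hσϖ hϖ0 hbrev⟩ : GL (Fin N) K) = zpowDiagGL hϖ0 E := by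
  refine Units.ext (Matrix.ext fun p q => ?_)
  rw [coe_blockDiagLift, coe_zpowDiagGL hϖ0 E]
  obtain ⟨x, rfl⟩ := (blockSum hc).surjective p
  obtain ⟨y, rfl⟩ := (blockSum hc).surjective q
  rcases x with (i | i) | i <;> rcases y with (j | j) | j <;>
    simp only [blockSum_inl_inl, blockSum_inl_inr, blockSum_inr]
  · rw [blockDiagMatrix_castLE_castLE, coe_zpowDiagGL, Matrix.diagonal_apply, Matrix.diagonal_apply, hE0]
    simp only [(Fin.castLE_injective (le_of_two_mul_le hc)).eq_iff]
  · rw [blockDiagMatrix_apply_of_ne hc _ _ _ (by rw [blockLabel_castLE hc, blockLabel_midIndex hc]; decide),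
      Matrix.diagonal_apply_ne _ (ne_of_apply_ne (blockLabel N c) (by rw [blockLabel_castLE hc, blockLabel_midIndex hc]; decide))]
  · rw [blockDiagMatrix_apply_of_ne hc _ _ _ (by rw [blockLabel_castLE hc, blockLabel_hiIndex hc]; decide),
      Matrix.diagonal_apply_ne _ (ne_of_apply_ne (blockLabel N c) (by rw [blockLabel_castLE hc, blockLabel_hiIndex hc]; decide))]
  · rw [blockDiagMatrix_apply_of_ne hc _ _ _ (by rw [blockLabel_castLE hc, blockLabel_midIndex hc]; decide),
      Matrix.diagonal_apply_ne _ (ne_of_apply_ne (blockLabel N c) (by rw [blockLabel_castLE hc, blockLabel_midIndex hc]; decide))]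
  · rw [blockDiagMatrix_midIndex_midIndex]
    change ((zpowDiagGL hϖ0 b : GL (Fin (N - 2 * c)) K) : Matrix _ _ K) i j = _
    rw [coe_zpowDiagGL, Matrix.diagonal_apply, Matrix.diagonal_apply, hE1]
    simp only [(midIndex_injective hc).eq_iff]
  · rw [blockDiagMatrix_apply_of_ne hc _ _ _ (by rw [blockLabel_hiIndex hc, blockLabel_midIndex hc]; decide),
      Matrix.diagonal_apply_ne _ (ne_of_apply_ne (blockLabel N c) (by rw [blockLabel_hiIndex hc, blockLabel_midIndex hc]; decide))]
  · rw [blockDiagMatrix_apply_of_ne hc _ _ _ (by rw [blockLabel_castLE hc, blockLabel_hiIndex hc]; decide),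
      Matrix.diagonal_apply_ne _ (ne_of_apply_ne (blockLabel N c) (by rw [blockLabel_castLE hc, blockLabel_hiIndex hc]; decide))]
  · rw [blockDiagMatrix_apply_of_ne hc _ _ _ (by rw [blockLabel_hiIndex hc, blockLabel_midIndex hc]; decide),
      Matrix.diagonal_apply_ne _ (ne_of_apply_ne (blockLabel N c) (by rw [blockLabel_hiIndex hc, blockLabel_midIndex hc]; decide))]
  · rw [blockDiagMatrix_hiIndex_hiIndex, dualBlock_apply, ← zpowDiagGL_neg, coe_zpowDiagGL, Matrix.diagonal_apply, Matrix.diagonal_apply, hE2]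
    by_cases hij : i = j
    · subst hij
      rw [if_pos rfl, if_pos rfl, Pi.neg_apply, map_zpow₀, hσϖ]
    · rw [if_neg (fun h => hij (Fin.rev_injective h).symm), if_neg (fun h => hij (hiIndex_injective hc h)), map_zero]

end Torus

/-! ## §3 The Cartan decomposition of the maximal Witt Levi `M_{univ ∖ α}` -/

section Levi

variable {K : Type*} [Field K] [Valued K ℤᵐ⁰] [ValuativeRel K] [(Valued.v : Valuation K ℤᵐ⁰).Compatible]

/-- Integrality of the entries of `k⁻¹` and `(k⁻¹)⁻¹` for `k ∈ GL_c(𝒪)` (★ `mem_glInt_iff`, in the `Valued` spelling ★ `v_le_one_iff_mem_integer`).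
[cite: CartierCorvallis1979, §IV.1] -/
theorem v_inv_le_one_of_mem_glInt {c : ℕ} {k : GL (Fin c) K} (hk : k ∈ glInt c K) :
    (∀ i j, Valued.v (((k⁻¹ : GL (Fin c) K) : Matrix (Fin c) (Fin c) K) i j) ≤ 1) ∧
      ∀ i j, Valued.v ((((k⁻¹)⁻¹ : GL (Fin c) K) : Matrix (Fin c) (Fin c) K) i j) ≤ 1 := by
  obtain ⟨h1, h2⟩ := (mem_glInt_iff _).1 hk
  exact ⟨fun i j => (v_le_one_iff_mem_integer _).2 (h2 i j), fun i j => by rw [inv_inv]; exact (v_le_one_iff_mem_integer _).2 (h1 i j)⟩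

/-- **`hcartanLevi(S)` AT THE UNRAMIFIED QUASI-SPLIT PLACES FOR THE MAXIMAL LEVIS `S = univ.erase α`** — the first rung `#(univ ∖ S) = 1` of item (B), in the FROZEN
shape of the line lead's RULINGS #1 (= the `hcartan` binder of ★ `isAdmissible_levi_of_forall_ssubset_of_leviCartan_compact` with `K₀ = unitaryInt σ W`): for `K`
with ★ `UnramifiedLocalConjDatum σ ϖ`, `W = wittFormOn e Han` of type `(r, m)`, `m ≤ 1`, standard indexing, `Han ≡ 1`, every `g ∈ M = M_{univ∖α}` is
`k₁ · ∏_{β ≠ α} a_β(ϖ)^{n β} · k₂ · z` with `k₁, k₂ ∈ K₀ ∩ M`, `n ≥ 0`, `z ∈ Z(M)`.  Proof: `M ≅ GL_c × U(J₀^{(N−2c)})` (★ part 1 `eq_of_loBlockGL_eq_of_midBlockU_eq`), Cartan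
of the two factors (★ `exists_glInt_mul_mul_eq_zpowDiagGL`, ★ `heckeCosetMk_zpowDiagGL_eq_of_unitary`), glued torus element `ϖ^E` (§2) with `E = E′ + χ`, `χ`
central (§4 of part 1), `ϖ^{E′} = ∏_{β ≠ α} a_β(ϖ)^{n β}` (★ `prod_wittCoweight_pow_eq_zpow`, the `α`-exponent vanishing).
[cite: BruhatTits1972, (4.4.3)] [cite: Tits1979, §3.3.3] [cite: CartierCorvallis1979, §IV.2] [cite: Casselman1995, Thm. 5.3.1] -/
theorem exists_leviCartan_unramified_erase {σ : K →+* K} {ϖ : K} (hd : UnramifiedLocalConjDatum σ ϖ) {N r m : ℕ} (hm : m ≤ 1)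
    (e : WittIndex r m ≃ Fin N)
    (hstd : ∀ x, (e x).val = Sum.elim (fun i : Fin r => i.val) (Sum.elim (fun u : Fin m => r + u.val) (fun j : Fin r => r + m + j.val)) x)
    (Han : Matrix (Fin m) (Fin m) K) (hHan : ∀ u u' : Fin m, Han u u' = 1) (α : Fin r)
    (g : ↥(wittLevi σ (wittFormOn e Han) e (Finset.univ.erase α))) :
    ∃ k₁ ∈ (unitaryInt σ (wittFormOn e Han)).subgroupOf (wittLevi σ (wittFormOn e Han) e (Finset.univ.erase α)),
    ∃ k₂ ∈ (unitaryInt σ (wittFormOn e Han)).subgroupOf (wittLevi σ (wittFormOn e Han) e (Finset.univ.erase α)),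
    ∃ n : ↥(Finset.univ.erase α) → ℕ, ∃ z ∈ Subgroup.center ↥(wittLevi σ (wittFormOn e Han) e (Finset.univ.erase α)),
      g = k₁ * Finset.univ.noncommProd
        (fun β : ↥(Finset.univ.erase α) => (⟨wittCocharacter σ hd.σσ e Han β (Units.mk0 ϖ hd.ϖ_ne_zero),
          wittCocharacter_mem_wittLevi σ hd.σσ e Han β (Units.mk0 ϖ hd.ϖ_ne_zero) (Finset.univ.erase α)⟩ :
            ↥(wittLevi σ (wittFormOn e Han) e (Finset.univ.erase α))) ^ n β)
        (fun β _ β' _ _ => (commute_wittCocharacter_levi σ hd.σσ e Han β β' (Units.mk0 ϖ hd.ϖ_ne_zero) (Finset.univ.erase α)).pow_pow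
          (n β) (n β')) * k₂ * z := by
  classical
  -- §3.0 notation: `J₀`, `Φ : U(σ, W) ≃* U(σ, J₀)`, `c = α + 1`, the block-diagonality of `g`
  have hN : N = r + (m + r) := by simpa using (Fintype.card_congr e).symm
  have hc : 2 * (α.val + 1) ≤ N := two_mul_succ_le e hstd α
  have h0 : ϖ ≠ 0 := hd.ϖ_ne_zero
  have hW : wittFormOn e Han = (StdForm.antidiagonal N).over K := wittFormOn_eq_over_of_std hm e hstd Han hHan
  have hU : unitaryGroupOfForm σ (wittFormOn e Han) = unitaryGroupOfForm σ ((StdForm.antidiagonal N).over K) := by rw [hW]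
  set Φ := MulEquiv.subgroupCongr hU with hΦ
  have hbdW : ∀ x : ↥(unitaryGroupOfForm σ (wittFormOn e Han)), x ∈ wittLevi σ (wittFormOn e Han) e (Finset.univ.erase α) ↔
      ∀ i j, blockLabel N (α.val + 1) i ≠ blockLabel N (α.val + 1) j → ((x : GL (Fin N) K) : Matrix (Fin N) (Fin N) K) i j = 0 :=
    fun x => mem_wittLevi_erase_iff e hstd σ (wittFormOn e Han) α x
  have hgbd := (hbdW g).1 g.2
  set q : ↥(blockParabolic σ N (α.val + 1)) := ⟨Φ g, mem_blockParabolic_of_apply_eq_zero fun i j h => hgbd i j h⟩ with hq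
  -- §3.1 Cartan decompositions of the two blocks
  haveI := isDiscreteValuationRing_integer_of_compatible (K := K) hd.vϖ
  obtain ⟨k₁, hk₁, k₂, hk₂, a, ha, hA⟩ := exists_glInt_mul_mul_eq_zpowDiagGL (isUniformizingElement_of_v_eq hd.vϖ) (loBlockGL hc q)
  obtain ⟨b, hb2, hcoset⟩ := heckeCosetMk_zpowDiagGL_eq_of_unitary hd (midBlockU hc q)
  obtain ⟨κ₁, hκ₁, κ₂, hκ₂, hB⟩ := (heckeAlgebra.heckeCosetMk_eq_iff _ _ _).1 hcoset
  set Db : ↥(unitaryGroupOfForm σ ((StdForm.antidiagonal (N - 2 * (α.val + 1))).over K)) :=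
    ⟨zpowDiagGL h0 b, zpowDiagGL_mem_unitaryGroupOfForm hd.σϖ h0 hb2.2⟩ with hDb
  have hA' : loBlockGL hc q = k₁⁻¹ * zpowDiagGL h0 a * k₂⁻¹ := by
    rw [← hA]; group
  -- §3.2 the three lifts and `Φ g = L₁ · Dm · L₂`
  set P₁ : ↥(blockParabolic σ N (α.val + 1)) := ⟨blockDiagLift hd.σσ hc k₁⁻¹ κ₁, blockDiagLift_mem_blockParabolic hd.σσ hc k₁⁻¹ κ₁⟩ with hP₁
  set P₂ : ↥(blockParabolic σ N (α.val + 1)) := ⟨blockDiagLift hd.σσ hc k₂⁻¹ κ₂, blockDiagLift_mem_blockParabolic hd.σσ hc k₂⁻¹ κ₂⟩ with hP₂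
  set PD : ↥(blockParabolic σ N (α.val + 1)) :=
    ⟨blockDiagLift hd.σσ hc (zpowDiagGL h0 a) Db, blockDiagLift_mem_blockParabolic hd.σσ hc (zpowDiagGL h0 a) Db⟩ with hPD
  have hbdmul : ∀ {X Y : ↥(unitaryGroupOfForm σ ((StdForm.antidiagonal N).over K))},
      (∀ i j, blockLabel N (α.val + 1) i ≠ blockLabel N (α.val + 1) j → ((X : GL (Fin N) K) : Matrix (Fin N) (Fin N) K) i j = 0) →
      (∀ i j, blockLabel N (α.val + 1) i ≠ blockLabel N (α.val + 1) j → ((Y : GL (Fin N) K) : Matrix (Fin N) (Fin N) K) i j = 0) →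
      ∀ i j, blockLabel N (α.val + 1) i ≠ blockLabel N (α.val + 1) j → (((X * Y : ↥(unitaryGroupOfForm σ ((StdForm.antidiagonal N).over K))) : GL (Fin N) K) :
        Matrix (Fin N) (Fin N) K) i j = 0 := by
    intro X Y hX hY i j hij
    rw [Subgroup.coe_mul, Units.val_mul]
    exact mul_apply_eq_zero_of_blockDiagonal hX hY hij
  have hbd₁ : ∀ i j, blockLabel N (α.val + 1) i ≠ blockLabel N (α.val + 1) j →
      (((P₁ : ↥(unitaryGroupOfForm σ ((StdForm.antidiagonal N).over K))) : GL (Fin N) K) : Matrix (Fin N) (Fin N) K) i j = 0 :=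
    fun i j hij => blockDiagLift_apply_of_ne hd.σσ hc k₁⁻¹ κ₁ hij
  have hbd₂ : ∀ i j, blockLabel N (α.val + 1) i ≠ blockLabel N (α.val + 1) j →
      (((P₂ : ↥(unitaryGroupOfForm σ ((StdForm.antidiagonal N).over K))) : GL (Fin N) K) : Matrix (Fin N) (Fin N) K) i j = 0 :=
    fun i j hij => blockDiagLift_apply_of_ne hd.σσ hc k₂⁻¹ κ₂ hij
  have hbdD : ∀ i j, blockLabel N (α.val + 1) i ≠ blockLabel N (α.val + 1) j →
      (((PD : ↥(unitaryGroupOfForm σ ((StdForm.antidiagonal N).over K))) : GL (Fin N) K) : Matrix (Fin N) (Fin N) K) i j = 0 :=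
    fun i j hij => blockDiagLift_apply_of_ne hd.σσ hc (zpowDiagGL h0 a) Db hij
  have hq : (q : ↥(unitaryGroupOfForm σ ((StdForm.antidiagonal N).over K))) = P₁ * PD * P₂ := by
    refine eq_of_loBlockGL_eq_of_midBlockU_eq hd.σσ hc q (P₁ * PD * P₂) (fun i j h => hgbd i j h) ?_ ?_ ?_
    · intro i j hij
      exact hbdmul (hbdmul hbd₁ hbdD) hbd₂ i j hij
    · rw [map_mul, map_mul, hP₁, hPD, hP₂, loBlockGL_blockDiagLift, loBlockGL_blockDiagLift, loBlockGL_blockDiagLift, hA']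
    · rw [map_mul, map_mul, hP₁, hPD, hP₂, midBlockU_blockDiagLift, midBlockU_blockDiagLift, midBlockU_blockDiagLift, hB]
  -- §3.3 the exponents `E = (a | b | −a ∘ rev)`, `t`, `χ = t (1 − label)`, `E′ = E − χ`
  set t : ℤ := a ⟨α.val, Nat.lt_succ_self _⟩ - (if h : 0 < N - 2 * (α.val + 1) then b ⟨0, h⟩ else 0) with ht
  set E : Fin N → ℤ := fun p => Sum.elim (Sum.elim a b) (fun i => -a (Fin.rev i)) ((blockSum hc).symm p) with hE
  have hE0 : ∀ i, E (Fin.castLE (le_of_two_mul_le hc) i) = a i := fun i => by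
    simp only [hE]
    rw [← blockSum_inl_inl hc, Equiv.symm_apply_apply, Sum.elim_inl, Sum.elim_inl]
  have hE1 : ∀ j, E (midIndex hc j) = b j := fun j => by
    simp only [hE]
    rw [← blockSum_inl_inr hc, Equiv.symm_apply_apply, Sum.elim_inl, Sum.elim_inr]
  have hE2 : ∀ i, E (hiIndex hc i) = -a (Fin.rev i) := fun i => by
    simp only [hE]
    rw [← blockSum_inr hc, Equiv.symm_apply_apply, Sum.elim_inr]
  set χ : Fin N → ℤ := fun p => t * (1 - (blockLabel N (α.val + 1) p : ℤ)) with hχ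
  set E' : Fin N → ℤ := fun p => E p - χ p with hE'
  have hE'0 : ∀ i, E' (Fin.castLE (le_of_two_mul_le hc) i) = a i - t := fun i => by
    simp only [hE', hχ, hE0, blockLabel_castLE hc, Nat.cast_zero, sub_zero, mul_one]
  have hE'1 : ∀ j, E' (midIndex hc j) = b j := fun j => by
    simp only [hE', hχ, hE1, blockLabel_midIndex hc, Nat.cast_one, sub_self, mul_zero, sub_zero]
  have hE'2 : ∀ i, E' (hiIndex hc i) = -a (Fin.rev i) + t := fun i => by
    simp only [hE', hχ, hE2, blockLabel_hiIndex hc, Nat.cast_ofNat]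
    ring
  have hχrev : ∀ p, χ (Fin.rev p) = -χ p := fun p => by
    simp only [hχ, blockLabel_rev hc, Nat.cast_sub (blockLabel_le_two p), Nat.cast_ofNat]
    ring
  have hEχ : E = E' + χ := funext fun p => by simp only [hE', Pi.add_apply, sub_add_cancel]
  -- §3.4 inequalities: `a` bounded below by its last value, `b 0 ≥ 0`, `b j ≥ −b 0`
  have halast : ∀ i : Fin (α.val + 1), a ⟨α.val, Nat.lt_succ_self _⟩ ≤ a i := fun i =>
    ha (Fin.le_iff_val_le_val.2 (Nat.le_of_lt_succ i.isLt))
  have hbfirst : ∀ j : Fin (N - 2 * (α.val + 1)), b j ≤ (if h : 0 < N - 2 * (α.val + 1) then b ⟨0, h⟩ else 0) := fun j => by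
    rw [dif_pos (by have := j.isLt; omega)]
    exact hb2.1 (Fin.le_iff_val_le_val.2 (Nat.zero_le _))
  have hblast : ∀ j : Fin (N - 2 * (α.val + 1)), -(if h : 0 < N - 2 * (α.val + 1) then b ⟨0, h⟩ else 0) ≤ b j := fun j => by
    have hpos : 0 < N - 2 * (α.val + 1) := by have := j.isLt; omega
    rw [dif_pos hpos, ← hb2.2 ⟨0, hpos⟩]
    refine hb2.1 (Fin.le_iff_val_le_val.2 ?_)
    rw [Fin.val_rev]
    change (j : ℕ) ≤ N - 2 * (α.val + 1) - (0 + 1)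
    have := j.isLt
    omega
  have hb0 : 0 ≤ (if h : 0 < N - 2 * (α.val + 1) then b ⟨0, h⟩ else 0) := by
    by_cases hpos : 0 < N - 2 * (α.val + 1)
    · have h := hblast ⟨0, hpos⟩
      rw [dif_pos hpos] at h ⊢
      omega
    · rw [dif_neg hpos]
  -- §3.5 `E′` is antitone and `rev`-antisymmetric
  have hanti : Antitone E' := by
    refine antitone_of_blockwise hc (fun i i' h => ?_) (fun j j' h => ?_) (fun i i' h => ?_) (fun i j => ?_) (fun i i' => ?_) (fun j i' => ?_)
    · rw [hE'0, hE'0]; have := ha h; omega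
    · rw [hE'1, hE'1]; exact hb2.1 h
    · rw [hE'2, hE'2]; have := ha (Fin.rev_le_rev.2 h); omega
    · rw [hE'0, hE'1]; have := hbfirst j; have := halast i; omega
    · rw [hE'0, hE'2]; have := halast i; have := halast (Fin.rev i'); omega
    · rw [hE'1, hE'2]; have := hblast j; have := halast (Fin.rev i'); omega
  have hrev : ∀ p, E' (Fin.rev p) = -E' p :=
    rev_eq_neg_of_blockwise hc (fun i => by rw [hE'2, hE'0, Fin.rev_rev]; ring) (fun j => by rw [hE'1, hE'1, hb2.2])
  -- §3.6 the simple-root exponents of `E′`; the `α`-th one vanishes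
  set nE : Fin r → ℕ := fun γ => ((if h : γ.val < r then E' (e (Sum.inl ⟨γ.val, h⟩)) else 0) -
    (if h : γ.val + 1 < r then E' (e (Sum.inl ⟨γ.val + 1, h⟩)) else 0)).toNat with hnE
  have heα : e (Sum.inl α) = Fin.castLE (le_of_two_mul_le hc) ⟨α.val, Nat.lt_succ_self _⟩ :=
    Fin.ext (by rw [hstd, Fin.val_castLE]; rfl)
  have hnEα : nE α = 0 := by
    have h1 : (if h : α.val < r then E' (e (Sum.inl ⟨α.val, h⟩)) else 0) = a ⟨α.val, Nat.lt_succ_self _⟩ - t := by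
      rw [dif_pos α.isLt, show (⟨α.val, α.isLt⟩ : Fin r) = α from rfl, heα, hE'0]
    have h2 : (if h : α.val + 1 < r then E' (e (Sum.inl ⟨α.val + 1, h⟩)) else 0) =
        (if h : 0 < N - 2 * (α.val + 1) then b ⟨0, h⟩ else 0) := by
      by_cases hα : α.val + 1 < r
      · have hpos : 0 < N - 2 * (α.val + 1) := by omega
        have he : e (Sum.inl ⟨α.val + 1, hα⟩) = midIndex hc ⟨0, hpos⟩ := Fin.ext (by rw [hstd, coe_midIndex]; rfl)
        rw [dif_pos hα, dif_pos hpos, he, hE'1]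
      · rw [dif_neg hα]
        by_cases hpos : 0 < N - 2 * (α.val + 1)
        · -- `N − 2c = m = 1`: the middle exponent is `rev`-fixed, hence `0`
          rw [dif_pos hpos]
          have hm1 : N - 2 * (α.val + 1) = 1 := by omega
          have hfix : Fin.rev (⟨0, hpos⟩ : Fin (N - 2 * (α.val + 1))) = ⟨0, hpos⟩ := Fin.ext (by rw [Fin.val_rev]; omega)
          have h := hb2.2 ⟨0, hpos⟩
          rw [hfix] at h
          omega
        · rw [dif_neg hpos]
    change ((if h : α.val < r then E' (e (Sum.inl ⟨α.val, h⟩)) else 0) -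
      (if h : α.val + 1 < r then E' (e (Sum.inl ⟨α.val + 1, h⟩)) else 0)).toNat = 0
    rw [h1, h2, ht, sub_sub_cancel, sub_self]  -- `(a_c − (a_c − b₀)) − b₀ = 0`
    rfl
  -- §3.7 the cone product over `β ≠ α` has matrix `ϖ^{E′}`
  have hϖu : Units.mk0 ϖ hd.ϖ_ne_zero = Units.mk0 ϖ h0 := rfl
  have hconeS : (((Finset.univ.noncommProd
      (fun β : ↥(Finset.univ.erase α) => wittCocharacter σ hd.σσ e Han (β : Fin r) (Units.mk0 ϖ hd.ϖ_ne_zero) ^ nE β)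
      (fun β _ β' _ _ => (commute_wittCocharacter σ e hd.σσ Han (β : Fin r) (β' : Fin r) (Units.mk0 ϖ hd.ϖ_ne_zero)
        (Units.mk0 ϖ hd.ϖ_ne_zero)).pow_pow (nE β) (nE β')) : ↥(unitaryGroupOfForm σ (wittFormOn e Han))) : GL (Fin N) K) :
        Matrix (Fin N) (Fin N) K) = Matrix.diagonal fun k => ϖ ^ E' k := by
    rw [coe_noncommProd_wittCocharacter_pow_family σ e Han hd.σσ (Units.mk0 ϖ hd.ϖ_ne_zero) (fun β : ↥(Finset.univ.erase α) => (β : Fin r)) fun β => nE β]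
    congr 1
    funext k
    rw [Finset.prod_coe_sort (Finset.univ.erase α) (fun γ => ((wittCoweight σ γ (Units.mk0 ϖ hd.ϖ_ne_zero) (e.symm k) : Kˣ) : K) ^ nE γ),
      Finset.prod_erase _ (by rw [hnEα, pow_zero])]
    exact prod_wittCoweight_pow_eq_zpow σ e hstd hm hanti hrev h0 hd.σϖ k
  -- §3.8 the glued torus element and the centre witness `z = ϖ^χ`
  have hDm : (((PD : ↥(unitaryGroupOfForm σ ((StdForm.antidiagonal N).over K))) : GL (Fin N) K)) = zpowDiagGL h0 E := coe_blockDiagLift_zpowDiagGL hd.σσ hc h0 hd.σϖ a hb2.2 E hE0 hE1 hE2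
  set zJ : ↥(unitaryGroupOfForm σ ((StdForm.antidiagonal N).over K)) := ⟨zpowDiagGL h0 χ, zpowDiagGL_mem_unitaryGroupOfForm hd.σϖ h0 hχrev⟩ with hzJ
  have hzbd : ∀ i j, blockLabel N (α.val + 1) i ≠ blockLabel N (α.val + 1) j →
      (((Φ.symm zJ : ↥(unitaryGroupOfForm σ (wittFormOn e Han))) : GL (Fin N) K) : Matrix (Fin N) (Fin N) K) i j = 0 := fun i j hij => by
    change ((zpowDiagGL h0 χ : GL (Fin N) K) : Matrix (Fin N) (Fin N) K) i j = 0
    rw [coe_zpowDiagGL, Matrix.diagonal_apply_ne _ (ne_of_apply_ne _ hij)]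
  have hzM : Φ.symm zJ ∈ wittLevi σ (wittFormOn e Han) e (Finset.univ.erase α) := (hbdW _).2 hzbd
  have hzcomm : ∀ y : ↥(unitaryGroupOfForm σ (wittFormOn e Han)), y ∈ wittLevi σ (wittFormOn e Han) e (Finset.univ.erase α) → Commute (Φ.symm zJ) y :=
    fun y hy => commute_of_coe_eq_diagonal_of_blockConst (blockLabel N (α.val + 1)) (d := fun p => ϖ ^ χ p) (coe_zpowDiagGL h0 χ)
      (fun i j hij => by simp only [hχ, hij]) ((hbdW y).1 hy)
  have hzcenter : (⟨Φ.symm zJ, hzM⟩ : ↥(wittLevi σ (wittFormOn e Han) e (Finset.univ.erase α))) ∈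
      Subgroup.center ↥(wittLevi σ (wittFormOn e Han) e (Finset.univ.erase α)) := by
    rw [Subgroup.mem_center_iff]
    intro y
    exact Subtype.ext ((hzcomm y y.2).eq.symm)
  -- §3.9 memberships of the two compact factors
  have hK₁int : Φ.symm (P₁ : ↥(unitaryGroupOfForm σ ((StdForm.antidiagonal N).over K))) ∈ unitaryInt σ (wittFormOn e Han) :=
    mem_unitaryInt_iff.2 (mem_unitaryInt_iff.1
      (blockDiagLift_mem_unitaryInt hd.σσ hd.vσ hc (v_inv_le_one_of_mem_glInt hk₁).1 (v_inv_le_one_of_mem_glInt hk₁).2 hκ₁))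
  have hK₂int : Φ.symm (P₂ : ↥(unitaryGroupOfForm σ ((StdForm.antidiagonal N).over K))) ∈ unitaryInt σ (wittFormOn e Han) :=
    mem_unitaryInt_iff.2 (mem_unitaryInt_iff.1
      (blockDiagLift_mem_unitaryInt hd.σσ hd.vσ hc (v_inv_le_one_of_mem_glInt hk₂).1 (v_inv_le_one_of_mem_glInt hk₂).2 hκ₂))
  have hK₁M : Φ.symm (P₁ : ↥(unitaryGroupOfForm σ ((StdForm.antidiagonal N).over K))) ∈ wittLevi σ (wittFormOn e Han) e (Finset.univ.erase α) := (hbdW _).2 hbd₁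
  have hK₂M : Φ.symm (P₂ : ↥(unitaryGroupOfForm σ ((StdForm.antidiagonal N).over K))) ∈ wittLevi σ (wittFormOn e Han) e (Finset.univ.erase α) := (hbdW _).2 hbd₂
  -- §3.10 assembly
  refine ⟨⟨_, hK₁M⟩, Subgroup.mem_subgroupOf.2 hK₁int, ⟨_, hK₂M⟩, Subgroup.mem_subgroupOf.2 hK₂int, fun β => nE β, ⟨_, hzM⟩, hzcenter, Subtype.ext ?_⟩
  -- in `U(σ, W)`
  have hgU : (g : ↥(unitaryGroupOfForm σ (wittFormOn e Han))) =
      Φ.symm (P₁ : ↥(unitaryGroupOfForm σ ((StdForm.antidiagonal N).over K))) * Φ.symm (PD : ↥(unitaryGroupOfForm σ ((StdForm.antidiagonal N).over K))) * Φ.symm (P₂ : ↥(unitaryGroupOfForm σ ((StdForm.antidiagonal N).over K))) := by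
    have h := congrArg Φ.symm hq
    rw [MulEquiv.symm_apply_apply] at h   -- `Φ.symm (Φ g) = g`; `(q : U) = Φ g` by `rfl`
    rw [h, map_mul, map_mul]
  have hDU : Φ.symm (PD : ↥(unitaryGroupOfForm σ ((StdForm.antidiagonal N).over K))) =
      Finset.univ.noncommProd
        (fun β : ↥(Finset.univ.erase α) => wittCocharacter σ hd.σσ e Han (β : Fin r) (Units.mk0 ϖ hd.ϖ_ne_zero) ^ nE β)
        (fun β _ β' _ _ => (commute_wittCocharacter σ e hd.σσ Han (β : Fin r) (β' : Fin r) (Units.mk0 ϖ hd.ϖ_ne_zero)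
          (Units.mk0 ϖ hd.ϖ_ne_zero)).pow_pow (nE β) (nE β')) * Φ.symm zJ := by
    refine Subtype.ext (Units.ext ?_)
    rw [Subgroup.coe_mul, Units.val_mul, hconeS]
    change ((((PD : ↥(unitaryGroupOfForm σ ((StdForm.antidiagonal N).over K))) : GL (Fin N) K)) : Matrix (Fin N) (Fin N) K) =
      (Matrix.diagonal fun k => ϖ ^ E' k) * ((zpowDiagGL h0 χ : GL (Fin N) K) : Matrix (Fin N) (Fin N) K)
    rw [hDm, hEχ, zpowDiagGL_add, Units.val_mul, coe_zpowDiagGL, coe_zpowDiagGL]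
  have hzc := (hzcomm _ hK₂M).eq
  -- the `M`-level cone product maps to the `U(σ, W)`-level one
  have hPM : ((Finset.univ.noncommProd
      (fun β : ↥(Finset.univ.erase α) => (⟨wittCocharacter σ hd.σσ e Han β (Units.mk0 ϖ hd.ϖ_ne_zero),
        wittCocharacter_mem_wittLevi σ hd.σσ e Han β (Units.mk0 ϖ hd.ϖ_ne_zero) (Finset.univ.erase α)⟩ :
          ↥(wittLevi σ (wittFormOn e Han) e (Finset.univ.erase α))) ^ nE β)
      (fun β _ β' _ _ => (commute_wittCocharacter_levi σ hd.σσ e Han β β' (Units.mk0 ϖ hd.ϖ_ne_zero) (Finset.univ.erase α)).pow_pow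
        (nE β) (nE β')) : ↥(wittLevi σ (wittFormOn e Han) e (Finset.univ.erase α))) : ↥(unitaryGroupOfForm σ (wittFormOn e Han))) =
      Finset.univ.noncommProd
        (fun β : ↥(Finset.univ.erase α) => wittCocharacter σ hd.σσ e Han (β : Fin r) (Units.mk0 ϖ hd.ϖ_ne_zero) ^ nE β)
        (fun β _ β' _ _ => (commute_wittCocharacter σ e hd.σσ Han (β : Fin r) (β' : Fin r) (Units.mk0 ϖ hd.ϖ_ne_zero)
          (Units.mk0 ϖ hd.ϖ_ne_zero)).pow_pow (nE β) (nE β')) := by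
    rw [← Subgroup.coe_subtype, Finset.map_noncommProd]
    exact Finset.noncommProd_congr rfl (fun β _ => by rw [map_pow, Subgroup.coe_subtype]) _
  beta_reduce
  rw [Subgroup.coe_mul, Subgroup.coe_mul, Subgroup.coe_mul, hPM, hgU, hDU]
  simp only [mul_assoc, hzc]

end Levi

end Summit.HodgeConjecture.HodgeConjecture.Cruxes.H413.K2E3WittLeviCartanUnramifiedMaximal

end
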